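import Summits.NavierStokesRegularity.FluidComputer.PalasekTowerHeredityOrBreakdown

/-!
# REGISTER v2.3′: the a-priori ceiling SPLITS — «no premature breakdown» × the WINDOW CEILING of the survivors

Cell `ns-blowup`, seat `ns-palasek-19250-p2` (g2; STUB-WORKER on `stub_apriori_ceiling : AprioriCeiling` of
crux stmt-NavierStokesRegularity-19250 `HeredityFromTwo`, skeleton v3 c7f4b5fa45c722f3). Companion of
`PalasekTowerHeredityOrBreakdown.lean` (this seat, p473253: `Schedule.LivesTo`, `HeredityOrBreakdownAt/From`,
`NoPrematureBreakdownAt`, the breakdown door and the weak closer). LABEL: E–C typing (KERNEL vocabulary +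
glue; every implication proved). WHAT THIS IS NOT: not Navier–Stokes evidence — no schedule, stage, flow
or tower is constructed; the named open `Prop` `WindowCeilingAt k` is NEVER asserted; nothing here claims
regularity or blow-up, and no stub is decided.

## What is proved

* §1 `Stage.exists_pressure_regauge` — a classical solution on `[0, T'] ⊇ [0, τ k]` agreeing with a stage
  in VELOCITY is re-gauged (pressure shifted by a smooth function of time) to agree in velocity AND
  pressure (steps (1)–(2) of `Stage.exists_extends_of_velocity_continuation`, for any `T'`).
* §2 `WindowCeilingAt k` (never asserted): every SURVIVING registered flow (classical finite-energy solution
  of the design's system from the Clay datum on the full slab `[0, τ (k+1)]`) stays `≤ c₂ Y_{k+1}` on the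
  growth window. `HeredityOrBreakdownAt k → WindowCeilingAt k`.
* §3 **`AprioriCeiling ↔ (∀ k ≥ 2, NoPrematureBreakdownAt k) ∧ (∀ k ≥ 2, WindowCeilingAt k)`**: the
  registered UPPER stub of 19250 is the clause «no registered design dies inside a window» (whose failure
  IS Fefferman's (C), `navierStokesBreakdownR3_of_not_noPrematureBreakdownAt`) times the window ceiling of
  the survivors; and **`HeredityOrBreakdownFrom 2 ↔ (∀ k ≥ 2, WindowCeilingAt k) ∧ ReadoutFloors`**: the
  weak item keeps the register's LOWER half verbatim (hence the three `k`-uniform floor stubs of skeleton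
  v3, `readoutFloors_iff_forall_floors`) and replaces `AprioriCeiling` by the window ceiling. Altogether
  `HeredityFrom 2 ↔ (∀ k ≥ 2, NoPrematureBreakdownAt k) ∧ (∀ k ≥ 2, WindowCeilingAt k) ∧ ReadoutFloors`.

Uniqueness inputs are THEOREMS of the tree (forced Serrin–Masuda `velocity_eq_of_bounded_classical`,
`Stage.velocity_eq_of_classical`); no named fact is used.

References: S. Palasek, arXiv:2605.13827 §4 [cite: Palasek2026ElementaryModel, §4]; H. Sohr, *The
Navier–Stokes Equations*, Birkhäuser 2001, Ch. V Thm. 1.5.1 [cite: Sohr2001, Ch. V Thm. 1.5.1]; R. T.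
Seeley, Proc. AMS 15 (1964) 625–626 [cite: Seeley1964, Theorem]; C. L. Fefferman, Clay problem
description, (C) [cite: FeffermanClay2006, (C)].
-/

noncomputable section

namespace Summit.NavierStokesRegularity.FluidComputer.PalasekTowerClayBridge

open Set MeasureTheory Filter Topology Function
open scoped ENNReal ContDiff NNReal
open Literature.Analysis.FluidPDE
open Summit.NavierStokesRegularity.NavierStokesRegularity

/-! ## §1 Re-gauging a velocity continuation -/

namespace Stage

variable {ν : ℝ} {R : TowerRates} {S : Schedule R} {m : Margins R} {k : ℕ}

/-- **Re-gauging a velocity continuation** (any margins, rates, viscosity): a classical solution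
`(v, q)` of the design's system on `[0, T'] ⊇ [0, τ k]` whose VELOCITY agrees with the stage on
`[0, τ k]` can be re-gauged in pressure (by a smooth function of time alone) into a classical solution
`(v, P)` on `[0, T']` agreeing with the stage in velocity AND pressure on `[0, τ k]`. The pressures
differ on `[0, τ k]` by a function of time up to the endpoints (`pressure_gauge_eq_of_velocity_eq`);
that gauge is smooth on `[0, τ k]` and extends smoothly past `τ k` (`exists_contDiffOn_Ici_extension`,
Seeley); subtracting it does not touch `∇q`. (The steps (1)–(2) of
`exists_extends_of_velocity_continuation`, stated for any `T'`.) [cite: Seeley1964, Theorem] -/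
theorem exists_pressure_regauge (s : Stage ν R S m k) {T' : ℝ} (hT' : S.τ k ≤ T')
    {v : ℝ → EuclideanSpace ℝ (Fin 3) → EuclideanSpace ℝ (Fin 3)}
    {q : ℝ → EuclideanSpace ℝ (Fin 3) → ℝ}
    (hcl : IsClassicalNSSolutionOn (Icc 0 T') ν S.f v q)
    (hvel : ∀ t ∈ Icc 0 (S.τ k), v t = s.u t) :
    ∃ P : ℝ → EuclideanSpace ℝ (Fin 3) → ℝ,
      IsClassicalNSSolutionOn (Icc 0 T') ν S.f v P ∧ ∀ t ∈ Icc 0 (S.τ k), v t = s.u t ∧ P t = s.p t := by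
  have hτk : 0 < S.τ k := S.τ_pos k
  -- (1) pressure gauge: `s.p t x - s.p t 0 = q t x - q t 0` on `[0, τ k]`
  have hgauge : ∀ t ∈ Icc 0 (S.τ k), ∀ x, s.p t x - s.p t 0 = q t x - q t 0 :=
    pressure_gauge_eq_of_velocity_eq hτk hT' s.classical hcl hvel
  -- the gauge function `t ↦ s.p t 0 - q t 0`, smooth on `[0, τ k]`, extended past `τ k`
  have hslice0 : ∀ {T : ℝ} {w : ℝ → EuclideanSpace ℝ (Fin 3) → ℝ}, IsSmoothSpaceTimeOn (Icc 0 T) w →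
      ContDiffOn ℝ ∞ (fun t => w t 0) (Icc 0 T) := by
    intro T w hw
    have hc : ContDiff ℝ ∞ (fun t : ℝ => ((t, (0 : EuclideanSpace ℝ (Fin 3))) :
        ℝ × EuclideanSpace ℝ (Fin 3))) := contDiff_id.prodMk contDiff_const
    exact hw.comp hc.contDiffOn (fun t ht => mk_mem_prod ht (mem_univ _))
  have hc_smooth : ContDiffOn ℝ ∞ (fun t => s.p t 0 - q t 0) (Icc 0 (S.τ k)) :=
    (hslice0 s.classical.smooth_pressure).sub
      ((hslice0 hcl.smooth_pressure).mono (Icc_subset_Icc le_rfl hT'))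
  obtain ⟨e, he, hec⟩ := exists_contDiffOn_Ici_extension hτk hc_smooth
  -- (2) the re-gauged pressure `P t x = q t x - (- e t)`
  refine ⟨fun t x => q t x - (-e t), ⟨hcl.smooth_velocity, ?_, ?_, hcl.divFree⟩, fun t ht => ?_⟩
  · have he' : ContDiffOn ℝ ∞ (fun z : ℝ × EuclideanSpace ℝ (Fin 3) => -e z.1) (Icc 0 T' ×ˢ univ) :=
      (he.comp contDiff_fst.contDiffOn (fun z hz => (hz.1 : z.1 ∈ Icc 0 T').1)).neg
    exact ContDiffOn.sub hcl.smooth_pressure he'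
  · intro t ht x
    have hg : gradient (fun x => q t x - (-e t)) x = gradient (q t) x := gradient_sub_const (q t) (-e t) x
    rw [hg]
    exact hcl.momentum t ht x
  · refine ⟨hvel t ht, funext fun x => ?_⟩
    have h1 := hgauge t ht x
    have h2 : e t = s.p t 0 - q t 0 := hec ht
    show q t x - (-e t) = s.p t x
    linarith

end Stage

/-! ## §2 The window ceiling of the survivors (never asserted here) -/

/-- **The WINDOW CEILING at level `k`** (open; never asserted): for every pinned rigid quiet design on the
wide-base rates with a registered stage at level `k`, every classical finite-energy solution of the
design's system from its Clay datum on the FULL slab `[0, τ (k+1)]` (any pressure gauge) — i.e. the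
design's flow, WHEN IT LIVES to `τ (k+1)` — stays below `c₂ Y_{k+1}` on the growth window
`[τ k, τ (k+1)]`. No existence is asserted; designs that die before `τ (k+1)` satisfy it vacuously (they
are (C) witnesses). [cite: Palasek2026ElementaryModel, §4] -/
@[conjecture] def WindowCeilingAt (k : ℕ) : Prop :=
  ∀ S : Schedule TowerRates.wide, S.Pins 8 (6 / 5) → S.Rigid → S.Quiet →
    ∀ s : Stage 1 TowerRates.wide S (Margins.routeG TowerRates.wide) k,
    ∀ (v : ℝ → EuclideanSpace ℝ (Fin 3) → EuclideanSpace ℝ (Fin 3))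
      (q : ℝ → EuclideanSpace ℝ (Fin 3) → ℝ),
      IsClassicalNSSolutionOn (Icc 0 (S.τ (k + 1))) 1 S.f v q → v 0 = S.u₀ →
      (∃ C : ℝ≥0∞, C < ⊤ ∧ ∀ t ∈ Icc 0 (S.τ (k + 1)), ∫⁻ x, ‖v t x‖ₑ ^ 2 ≤ C) →
      ∀ t ∈ Icc (S.τ k) (S.τ (k + 1)), ∀ x, ‖v t x‖ ≤ S.c₂ * TowerRates.wide.Y (k + 1)

/-- The weak heredity at level `k` yields the window ceiling at level `k` (the survivor's flow IS the
extension's velocity, `Stage.velocity_eq_of_classical`). [cite: Sohr2001, Ch. V Thm. 1.5.1] -/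
theorem HeredityOrBreakdownAt.windowCeilingAt {k : ℕ} (h : HeredityOrBreakdownAt k) : WindowCeilingAt k := by
  intro S hP hR hQ s v q hcl hv0 hE t ht x
  rcases h S hP hR hQ s with hdead | ⟨s', -⟩
  · exact absurd ⟨v, q, hcl, hv0, hE⟩ hdead
  · have ht' : t ∈ Icc 0 (S.τ (k + 1)) := ⟨(S.τ_pos k).le.trans ht.1, ht.2⟩
    rw [s'.velocity_eq_of_classical one_pos le_rfl hcl hv0 hE t ht']
    exact s'.ceiling (k + 1) le_rfl t ht' x

/-! ## §3 The registered upper stub and the weak item, split -/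

/-- **The a-priori ceiling contains «no premature breakdown» at every `k ≥ 2`** (through
`continuationEnvelope_of_aprioriCeiling`: the envelope's continuation is a life of the design to
`τ (k+1)`). So the registered UPPER stub of 19250 carries the clause (C) does not need. [folklore] -/
theorem AprioriCeiling.noPrematureBreakdownAt (h : AprioriCeiling) {k : ℕ} (hk : 2 ≤ k) :
    NoPrematureBreakdownAt k := by
  rintro S hP hR hQ ⟨s⟩
  obtain ⟨u, p, hcl, hagree, hE, -⟩ := continuationEnvelope_of_aprioriCeiling h S hP hR hQ k hk s
  exact ⟨u, p, hcl, ((hagree 0 ⟨le_rfl, (S.τ_pos k).le⟩).1).trans s.initial, hE⟩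

/-- The a-priori ceiling yields the window ceiling at every `k ≥ 2` (re-gauge the survivor's pressure to
the stage's, `Stage.exists_pressure_regauge`, then read the ceiling at `T' = τ (k+1)`). [folklore] -/
theorem AprioriCeiling.windowCeilingAt (h : AprioriCeiling) {k : ℕ} (hk : 2 ≤ k) : WindowCeilingAt k := by
  intro S hP hR hQ s v q hcl hv0 hE t ht x
  have hτle : S.τ k ≤ S.τ (k + 1) := S.τ_mono (Nat.le_succ k)
  have hvel : ∀ t ∈ Icc 0 (S.τ k), v t = s.u t := s.velocity_eq_of_classical one_pos hτle hcl hv0 hE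
  obtain ⟨P, hclP, hagree⟩ := s.exists_pressure_regauge hτle hcl hvel
  exact h S hP hR hQ k hk s (S.τ (k + 1)) ⟨hτle, le_rfl⟩ v P hclP hagree hE t
    ⟨(S.τ_pos k).le.trans ht.1, ht.2⟩ x

/-- **`AprioriCeiling ↔ (∀ k ≥ 2, NoPrematureBreakdownAt k) ∧ (∀ k ≥ 2, WindowCeilingAt k)`** — the
registered upper stub of `HeredityFromTwo` is EXACTLY «no registered design dies inside a window» (whose
failure is (C), `navierStokesBreakdownR3_of_not_noPrematureBreakdownAt`) times «no SURVIVING registered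
flow overshoots». (←): a partial continuation on `[0, T'] ⊆ [0, τ (k+1)]` coincides there with the
surviving datum flow, which is bounded on the whole slab (stage ceiling before `τ k`, window ceiling
after), by forced Serrin–Masuda `velocity_eq_of_bounded_classical`. [cite: Sohr2001, Ch. V Thm. 1.5.1] -/
theorem aprioriCeiling_iff_noPrematureBreakdown_and_windowCeiling :
    AprioriCeiling ↔ (∀ k, 2 ≤ k → NoPrematureBreakdownAt k) ∧ (∀ k, 2 ≤ k → WindowCeilingAt k) := by
  refine ⟨fun h => ⟨fun k hk => h.noPrematureBreakdownAt hk, fun k hk => h.windowCeilingAt hk⟩,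
    fun ⟨hN, hW⟩ => ?_⟩
  intro S hP hR hQ k hk s T' hT' u p hcl hagree hE t ht x
  have hτk : 0 < S.τ k := S.τ_pos k
  have hτle : S.τ k ≤ S.τ (k + 1) := S.τ_mono (Nat.le_succ k)
  have hT'0 : 0 < T' := hτk.trans_le hT'.1
  -- the surviving datum flow `(v, q)` on `[0, τ (k+1)]`, bounded by `c₂ Y_{k+1}` throughout
  obtain ⟨v, q, hclv, hv0, hEv⟩ := hN k hk S hP hR hQ ⟨s⟩
  have hvel : ∀ t ∈ Icc 0 (S.τ k), v t = s.u t := s.velocity_eq_of_classical one_pos hτle hclv hv0 hEv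
  have hB : ∀ t ∈ Icc 0 (S.τ (k + 1)), ∀ x, ‖v t x‖ ≤ S.c₂ * TowerRates.wide.Y (k + 1) := by
    intro t ht x
    rcases le_or_gt t (S.τ k) with htk | htk
    · rw [hvel t ⟨ht.1, htk⟩]
      exact (s.ceiling k le_rfl t ⟨ht.1, htk⟩ x).trans
        (mul_le_mul_of_nonneg_left (TowerRates.wide.Y_le_Y_succ k) s.c₂_pos.le)
    · exact hW k hk S hP hR hQ s v q hclv hv0 hEv t ⟨htk.le, ht.2⟩ x
  -- the partial continuation `(u, p)` coincides with `v` on `[0, T']`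
  have hclv' : IsClassicalNSSolutionOn (Icc 0 T') 1 S.f v q :=
    hclv.mono (Icc_subset_Icc le_rfl hT'.2) (uniqueDiffOn_Icc hT'0)
  have hEv' : ∃ C : ℝ≥0∞, C < ⊤ ∧ ∀ t ∈ Icc 0 T', ∫⁻ x, ‖v t x‖ₑ ^ 2 ≤ C := by
    obtain ⟨C, hC, hb⟩ := hEv
    exact ⟨C, hC, fun t ht => hb t ⟨ht.1, ht.2.trans hT'.2⟩⟩
  have h0 : u 0 = v 0 := by
    rw [(hagree 0 ⟨le_rfl, hτk.le⟩).1, s.initial, hv0]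
  have huv : ∀ t ∈ Icc 0 T', u t = v t :=
    velocity_eq_of_bounded_classical one_pos hT'0 S.force_smooth S.force_decay hclv' hEv'
      (fun t ht => hB t ⟨ht.1, ht.2.trans hT'.2⟩) hcl hE h0
  rw [huv t ht]
  exact hB t ⟨ht.1, ht.2.trans hT'.2⟩ x

/-- **The weak item of 19250 in the register's halves:
`HeredityOrBreakdownFrom 2 ↔ (∀ k ≥ 2, WindowCeilingAt k) ∧ ReadoutFloors`** — the SAME lower half
(`ReadoutFloors`, hence the three registered `k`-uniform floor stubs via `readoutFloors_iff_forall_floors`)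
and the upper half with its existence clause removed. (→): the surviving / continued flow IS the
extension's velocity. (←): the survivor's flow, re-gauged to the stage's pressure
(`Stage.exists_pressure_regauge`), stays inside the ceiling (stage ceiling before `τ k`, window ceiling
after), shows the floors by `ReadoutFloors`, and `Stage.exists_extends_of_continuation` assembles the
level-`k+1` stage. [cite: Palasek2026ElementaryModel, §4] -/
theorem heredityOrBreakdownFrom_two_iff_windowCeiling_and_readoutFloors :
    HeredityOrBreakdownFrom 2 ↔ (∀ k, 2 ≤ k → WindowCeilingAt k) ∧ ReadoutFloors := by
  constructor
  · intro h
    refine ⟨fun k hk => (h k hk).windowCeilingAt, ?_⟩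
    intro S hP hR hQ k hk s u p hcl hagree hE _hceil
    rcases h k hk S hP hR hQ s with hdead | ⟨s', -⟩
    · exact absurd ⟨u, p, hcl, ((hagree 0 ⟨le_rfl, (S.τ_pos k).le⟩).1).trans s.initial, hE⟩ hdead
    · have hu0 : u 0 = S.u₀ := ((hagree 0 ⟨le_rfl, (S.τ_pos k).le⟩).1).trans s.initial
      have hτ : S.τ (k + 1) ∈ Icc 0 (S.τ (k + 1)) := ⟨(S.τ_pos (k + 1)).le, le_rfl⟩
      rw [s'.velocity_eq_of_classical one_pos le_rfl hcl hu0 hE _ hτ]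
      exact ⟨s'.floor (k + 1) le_rfl, s'.routeG_strain (k + 1) le_rfl, s'.routeG_coreLedger (k + 1) le_rfl⟩
  · rintro ⟨hW, hF⟩ k hk S hP hR hQ s
    by_cases hlive : S.LivesTo 1 (S.τ (k + 1))
    · refine Or.inr ?_
      obtain ⟨v, q, hcl, hv0, hE⟩ := hlive
      have hτle : S.τ k ≤ S.τ (k + 1) := S.τ_mono (Nat.le_succ k)
      have hvel : ∀ t ∈ Icc 0 (S.τ k), v t = s.u t :=
        s.velocity_eq_of_classical one_pos hτle hcl hv0 hE
      obtain ⟨P, hclP, hagree⟩ := s.exists_pressure_regauge hτle hcl hvel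
      have hceil : ∀ t ∈ Icc 0 (S.τ (k + 1)), ∀ x, ‖v t x‖ ≤ S.c₂ * TowerRates.wide.Y (k + 1) := by
        intro t ht x
        rcases le_or_gt t (S.τ k) with htk | htk
        · rw [hvel t ⟨ht.1, htk⟩]
          exact (s.ceiling k le_rfl t ⟨ht.1, htk⟩ x).trans
            (mul_le_mul_of_nonneg_left (TowerRates.wide.Y_le_Y_succ k) s.c₂_pos.le)
        · exact hW k hk S hP hR hQ s v q hcl hv0 hE t ⟨htk.le, ht.2⟩ x
      obtain ⟨hfloor, hstrain, hcore⟩ := hF S hP hR hQ k hk s v P hclP hagree hE hceil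
      exact s.exists_extends_of_continuation hR hclP hagree hE hceil hfloor hstrain hcore
    · exact Or.inl hlive

/-- Hence the register's item decomposes as
`HeredityFrom 2 ↔ (∀ k ≥ 2, NoPrematureBreakdownAt k) ∧ (∀ k ≥ 2, WindowCeilingAt k) ∧ ReadoutFloors`:
clause × window ceiling × floors. [folklore] -/
theorem heredityFrom_two_iff_noPrematureBreakdown_windowCeiling_floors :
    HeredityFrom 2 ↔ (∀ k, 2 ≤ k → NoPrematureBreakdownAt k) ∧ (∀ k, 2 ≤ k → WindowCeilingAt k) ∧
      ReadoutFloors := by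
  rw [heredityFrom_iff_orBreakdown_and_noPrematureBreakdown,
    heredityOrBreakdownFrom_two_iff_windowCeiling_and_readoutFloors]
  exact ⟨fun ⟨⟨hW, hF⟩, hN⟩ => ⟨hN, hW, hF⟩, fun ⟨hN, hW, hF⟩ => ⟨⟨hW, hF⟩, hN⟩⟩

end Summit.NavierStokesRegularity.FluidComputer.PalasekTowerClayBridge

end
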